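import Summits.NavierStokesRegularity.NavierStokesRegularity.Theorems.EfficiencyFloorNearSaturationNearMaximiserSeqCoreProfileVorticity
import Summits.NavierStokesRegularity.NavierStokesRegularity.Theorems.EfficiencyFloorNearSaturationNearMaximiserSeqCoreProfileUnique
import HarnessLib

/-!
# Route `EfficiencyFloor`, crux `NearSaturationNearMaximiser` (stmt-NavierStokesRegularity-25482) on the
# `ProductionEfficiencyDecay` ladder (stmt-22866): the regularity residue in SOBOLEV vocabulary — BY NAME

Def-free capstone of the weak-profile files (`…SeqCoreWeakProfile`, `…ProfileRegularity`, `…ProfileVorticity`, `…ProfileUnique`).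
The hypothesis of `nearSaturationNearMaximiser_of_sobolevProfileRegularity` now RECEIVES, for the weak-class limit profile `w₀` of a
centred normalised maximising subsequence, every structural fact the tree proves unconditionally:

* `(1+|x|)^{-3/2} w₀ ∈ L²(ℝ³)`;
* `HasWeakGradient w₀ G`, `G(x) = Σⱼ ⟪eⱼ, ·⟫ M_j(x)` with `M_j ∈ L²` — `w₀ ∈ W^{1,1}_{loc}`, `∇w₀ ∈ L²` (Evans §5.2.1 vocabulary);
* `Σⱼ ⟪eⱼ, M_j⟫ = 0` a.e. — `div w₀ = 0` distributionally;
* UNIQUENESS — any weighted-`L²` field with the same distributional gradient equals `w₀` a.e.;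
* the `H²` datum — `N_j ∈ L²` with `∫⟪Σᵢ eᵢ × M_i, ∂ⱼψ⟫ = −∫⟪N_j, ψ⟫` (`∇ curl w₀ ∈ L²`);

and must deliver only: `w₀` agrees a.e. with a `C^∞` field with `D⁰, D¹, D² ∈ L²`. That is the elliptic regularity (bootstrap from
the weak Euler–Lagrange system `(3c⋆/2)(Δ²−Δ)w + ∇π = ∇·G(∇w)`) and the square-integrability of the Lu–Doering extremising profile —
the exact open analytic content of stmt-25482 after this hand.

HONEST FRAMING: the hypothesis is NOT proved; stmt-25482, `LerayFloorGap`, `ProductionEfficiencyDecay` (stmt-22866) and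
Navier–Stokes regularity stay OPEN; no summit statement is proved. [folklore]
-/

-- the problem directory repeats the summit name (`NavierStokesRegularity/NavierStokesRegularity`)
set_option linter.dupNamespace false

noncomputable section

namespace Summit.NavierStokesRegularity.NavierStokesRegularity.Theorems

namespace NearSaturationNearMaximiser

namespace SeqCore

open Set MeasureTheory Filter Topology Function Real
open scoped InnerProductSpace ENNReal NNReal
open Literature.Analysis.FluidPDE
open Magsanop2026Enstrophy (slice_integrable)

/-! ## By name: stmt-25482 from the regularity of the Sobolev-class profile -/

/-- **`NearSaturationNearMaximiser` (stmt-25482) from regularity + decay of the SOBOLEV-class limit profile, BY NAME.** See the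
module docstring for the list of data the hypothesis receives (weighted `L²`, `HasWeakGradient`, distributional divergence-freeness,
uniqueness, `H²` datum in curl form); all of them are discharged here from `…SeqCoreProfileUnique`, `…ProfileRegularity`,
`…ProfileVorticity`. [folklore] -/
theorem nearSaturationNearMaximiser_of_sobolevProfileRegularity
    (HS : ∀ c : ℝ, (0 < c ∧ (∀ v : EuclideanSpace ℝ (Fin 3) → EuclideanSpace ℝ (Fin 3), (ContDiff ℝ (⊤ : ℕ∞) v ∧
      Literature.Analysis.FluidPDE.VectorCalculus.IsDivFree v ∧ (∫⁻ x, ‖iteratedFDeriv ℝ 0 v x‖ₑ ^ 2 < ⊤) ∧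
      (∫⁻ x, ‖iteratedFDeriv ℝ 1 v x‖ₑ ^ 2 < ⊤) ∧ (∫⁻ x, ‖iteratedFDeriv ℝ 2 v x‖ₑ ^ 2 < ⊤)) → (∫ x,
      ⟪Literature.Analysis.FluidPDE.curl v x, fderiv ℝ v x (Literature.Analysis.FluidPDE.curl v x)⟫_ℝ) ≤ c *
      (∫ x, ‖Literature.Analysis.FluidPDE.curl v x‖ ^ 2) ^ (3 / 4 : ℝ) * (∫ x,
      Literature.Analysis.FluidPDE.frobeniusNormSq (fderiv ℝ (Literature.Analysis.FluidPDE.curl v) x)) ^ (3 / 4 : ℝ)) ∧ ∀ c' : ℝ, (∀ w : EuclideanSpace ℝ (Fin 3) → EuclideanSpace ℝ (Fin 3), (ContDiff ℝ (⊤ : ℕ∞) w ∧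
      Literature.Analysis.FluidPDE.VectorCalculus.IsDivFree w ∧ (∫⁻ x, ‖iteratedFDeriv ℝ 0 w x‖ₑ ^ 2 < ⊤) ∧
      (∫⁻ x, ‖iteratedFDeriv ℝ 1 w x‖ₑ ^ 2 < ⊤) ∧ (∫⁻ x, ‖iteratedFDeriv ℝ 2 w x‖ₑ ^ 2 < ⊤)) → (∫ x,
      ⟪Literature.Analysis.FluidPDE.curl w x, fderiv ℝ w x (Literature.Analysis.FluidPDE.curl w x)⟫_ℝ) ≤ c' *
      (∫ x, ‖Literature.Analysis.FluidPDE.curl w x‖ ^ 2) ^ (3 / 4 : ℝ) * (∫ x,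
      Literature.Analysis.FluidPDE.frobeniusNormSq (fderiv ℝ (Literature.Analysis.FluidPDE.curl w) x)) ^ (3 / 4 : ℝ)) → c ≤ c') →
      ∀ K δ : ℝ, 0 < K → 0 < δ → ∀ v : ℕ → EuclideanSpace ℝ (Fin 3) → EuclideanSpace ℝ (Fin 3),
      (∀ n, (ContDiff ℝ (⊤ : ℕ∞) (v n) ∧
      Literature.Analysis.FluidPDE.VectorCalculus.IsDivFree (v n) ∧ (∫⁻ x, ‖iteratedFDeriv ℝ 0 (v n) x‖ₑ ^ 2 < ⊤) ∧
      (∫⁻ x, ‖iteratedFDeriv ℝ 1 (v n) x‖ₑ ^ 2 < ⊤) ∧ (∫⁻ x, ‖iteratedFDeriv ℝ 2 (v n) x‖ₑ ^ 2 < ⊤))) →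
      (∀ n, (∫ x, ‖Literature.Analysis.FluidPDE.curl (v n) x‖ ^ 2) = 1) →
      (∀ n, (∫ x, Literature.Analysis.FluidPDE.frobeniusNormSq (fderiv ℝ (Literature.Analysis.FluidPDE.curl (v n)) x)) = 1) →
      Tendsto (fun n => ∫ x, ⟪Literature.Analysis.FluidPDE.curl (v n) x, fderiv ℝ (v n) x
        (Literature.Analysis.FluidPDE.curl (v n) x)⟫_ℝ) atTop (𝓝 c) →
      (∀ᶠ n in atTop, δ ≤ ∫ x in Metric.ball (0 : EuclideanSpace ℝ (Fin 3)) K, ‖Literature.Analysis.FluidPDE.curl (v n) x‖ ^ 2) →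
      ∀ (φ₀ : ℕ → ℕ) (M : Fin 3 → EuclideanSpace ℝ (Fin 3) → EuclideanSpace ℝ (Fin 3)), StrictMono φ₀ →
      (∀ j, MemLp (M j) 2 volume) →
      (∀ (j : Fin 3) (ψ : EuclideanSpace ℝ (Fin 3) → EuclideanSpace ℝ (Fin 3)), MemLp ψ 2 volume →
        Tendsto (fun k => ∫ x, ⟪fderiv ℝ (v (φ₀ k)) x (EuclideanSpace.basisFun (Fin 3) ℝ j), ψ x⟫_ℝ) atTop
          (𝓝 (∫ x, ⟪M j x, ψ x⟫_ℝ))) →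
      ∀ w₀ : EuclideanSpace ℝ (Fin 3) → EuclideanSpace ℝ (Fin 3),
        MemLp (fun x => ((1 : ℝ) + ‖x‖) ^ (-(3 / 2 : ℝ)) • w₀ x) 2 volume →
        HasWeakGradient w₀ (fun x => ∑ j, (innerSL ℝ (EuclideanSpace.basisFun (Fin 3) ℝ j)).smulRight (M j x)) →
        ((fun x => ∑ j, ⟪EuclideanSpace.basisFun (Fin 3) ℝ j, M j x⟫_ℝ) =ᵐ[volume] fun _ => (0 : ℝ)) →
        (∀ w₀' : EuclideanSpace ℝ (Fin 3) → EuclideanSpace ℝ (Fin 3),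
          MemLp (fun x => ((1 : ℝ) + ‖x‖) ^ (-(3 / 2 : ℝ)) • w₀' x) 2 volume →
          (∀ (j : Fin 3) (ψ : EuclideanSpace ℝ (Fin 3) → EuclideanSpace ℝ (Fin 3)), ContDiff ℝ 1 ψ → HasCompactSupport ψ →
            ∫ x, ⟪w₀' x, fderiv ℝ ψ x (EuclideanSpace.basisFun (Fin 3) ℝ j)⟫_ℝ = -∫ x, ⟪M j x, ψ x⟫_ℝ) → w₀' =ᵐ[volume] w₀) →
        ∀ N : Fin 3 → EuclideanSpace ℝ (Fin 3) → EuclideanSpace ℝ (Fin 3), (∀ j, MemLp (N j) 2 volume) →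
        (∀ (j : Fin 3) (ψ : EuclideanSpace ℝ (Fin 3) → EuclideanSpace ℝ (Fin 3)), ContDiff ℝ 1 ψ → HasCompactSupport ψ →
          ∫ x, ⟪∑ i, cross (EuclideanSpace.basisFun (Fin 3) ℝ i) (M i x), fderiv ℝ ψ x (EuclideanSpace.basisFun (Fin 3) ℝ j)⟫_ℝ =
            -∫ x, ⟪N j x, ψ x⟫_ℝ) →
        ∃ w : EuclideanSpace ℝ (Fin 3) → EuclideanSpace ℝ (Fin 3), ContDiff ℝ (⊤ : ℕ∞) w ∧
          (∫⁻ x, ‖iteratedFDeriv ℝ 0 w x‖ₑ ^ 2 < ⊤) ∧ (∫⁻ x, ‖iteratedFDeriv ℝ 1 w x‖ₑ ^ 2 < ⊤) ∧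
          (∫⁻ x, ‖iteratedFDeriv ℝ 2 w x‖ₑ ^ 2 < ⊤) ∧ w =ᵐ[volume] w₀) :
    Summit.NavierStokesRegularity.NavierStokesRegularity.Theses.EfficiencyFloor.NearSaturationNearMaximiser := by
  refine nearSaturationNearMaximiser_of_profileRegularityH2
    fun c hsharp K δ hK hδ v hAdm hZ1 hP1 hS hcen φ₀ M hφ₀ hM hconv w₀ _ hw₀2 hprof N hN hNid => ?_
  have hu : ∀ k, ContDiff ℝ (⊤ : ℕ∞) (v (φ₀ k)) ∧ VectorCalculus.IsDivFree (v (φ₀ k)) ∧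
      (∫⁻ x, ‖iteratedFDeriv ℝ 0 (v (φ₀ k)) x‖ₑ ^ 2 < ⊤) ∧ (∫⁻ x, ‖iteratedFDeriv ℝ 1 (v (φ₀ k)) x‖ₑ ^ 2 < ⊤) ∧
      (∫⁻ x, ‖iteratedFDeriv ℝ 2 (v (φ₀ k)) x‖ₑ ^ 2 < ⊤) := fun k => hAdm (φ₀ k)
  exact HS c hsharp K δ hK hδ v hAdm hZ1 hP1 hS hcen φ₀ M hφ₀ hM hconv w₀ hw₀2
    (hasWeakGradient_of_weakProfile hw₀2 hM hprof) (weakLimit_trace_ae_eq_zero hu hM hconv)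
    (fun w₀' hw₀'2 hprof' => weakProfile_unique hw₀'2 hw₀2 hprof' hprof) N hN hNid

end SeqCore

end NearSaturationNearMaximiser

end Summit.NavierStokesRegularity.NavierStokesRegularity.Theorems

end
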